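import Literature.AlgebraicGeometry.HodgeTheory.HodgeTypePullbackVanishing
import Literature.AlgebraicGeometry.Motives.GAGAKaehlerImmersionProofs
import Literature.NumberTheory.Transcendental.ComplexDeRhamRealStructure
import HarnessLib

/-!
# The restricted Fubini–Study form is functorial: `(ι^an)^* θ_κ = θ_{ι ≫ κ}` (proved)

Family `hodge`, layer `Literature/AlgebraicGeometry/HodgeTheory`. Companion of
`GAGAKaehlerImmersionProofs` (the restricted Fubini–Study form
`θ_ι = fubiniStudyPullbackForm E ι φ` of a morphism `ι : X ⟶ ℙᴺ` on an analytification
`φ : M → X(ℂ)`: locally `Gⱼ^* β₀` for the affine coordinates `Gⱼ = (ι^*(xᵢ/xⱼ) ∘ φ)ᵢ`), of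
`KaehlerClass` (the hyperplane-type class `A^* H = e[θ] ⊗ 1` on the summit carrier) and of
`HodgeTypePullbackVanishing` (the holomorphic map `ι^an = HodgeModel.anMap B A ι` between Hodge
models over `ι(ℂ)`). It proves the naturality of `θ` in the morphism — the form-level content of
"the Kähler form of a projective submanifold is the restriction of the Fubini–Study form of the
ambient projective space" (Voisin I §3.3.2, after Lemma 3.16), which together with `b₂(ℙᴺ) = 1`
makes the hyperplane-type class of `X` the pull-back of a class of `ℙᴺ(ℂ)`:

* `GeneratingSections.chartLift_comp`, `GeneratingSections.homRatio_comp` — for `g : Y' ⟶ Y` and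
  `r : Y ⟶ ℙ(ι)`, the ratios of `g ≫ r` are the pulled-back ratios of `r`:
  `(g ≫ r)^*(x_j/x_i) = g^*(r^*(x_j/x_i))` on `(g ≫ r)⁻¹D₊(xᵢ) = g⁻¹(r⁻¹D₊(xᵢ))` (Hartshorne II
  Thm. 7.1 (a); uniqueness of lifts through the open immersion `D₊(xᵢ) → ℙ(ι)`, and
  `Scheme.Hom.resLE_app_top`);
* `GeneratingSections.evalOrZero_ratio_comp` — hence their (total) values at `L`-points:
  `(ι ≫ κ)^*(xᵢ/xⱼ)(P) = κ^*(xᵢ/xⱼ)(ι P)`;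
* `AnalytificationKaehler.coordVec_comp_eq`, `AnalytificationKaehler.mem_chartDom_comp_iff` — the
  affine coordinates and chart domains on analytifications are functorial along any `f : M → M'`
  over `ι(ℂ)`;
* `AnalytificationKaehler.fubiniStudyPullbackForm_pullback_comp` — **`f^* θ_κ = θ_{ι ≫ κ}`** for a
  closed immersion `κ : Y ⟶ ℙᴺ`, an analytification `ψ` of `Y`, and a holomorphic `f` over `ι(ℂ)`
  (chain rule on the `j`-th chart; the choice of chart is immaterial, `fsPullback_coordVec_eq`);
* `HodgeModel.fubiniStudyPullbackForm_pullback_anMap`, `HodgeModel.map_anMap_mk_fubiniStudyPullbackForm`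
  — the same for Hodge models `A` of `X`, `B` of `Y` (smooth projective) and `f = ι^an`, on forms and
  on complex de Rham classes: `(ι^an)^*_dR [θ_κ ⊗ 1] = [θ_{ι ≫ κ} ⊗ 1]`.

Everything is proved; no definitions, no named facts (D-0026). Consumer: the rationality of the
hyperplane-type class (`nonempty_hardLefschetzNFold`, via
`nonempty_hardLefschetzNFold_of_fubiniStudy_rational` of `HyperplaneClassLefschetzOperator`).

## References

* [VoisinHodgeI2002] C. Voisin, Hodge Theory and Complex Algebraic Geometry I (CUP 2002), §3.3.2
  (Lemma 3.16 and the remark following it).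
* [Hartshorne1977] R. Hartshorne, Algebraic Geometry (GTM 52, 1977), II Thm. 7.1 (a).
* [SerreGAGA1956] J.-P. Serre, Géométrie algébrique et géométrie analytique, Ann. Inst. Fourier 6
  (1956), §2 n°5.
-/

noncomputable section

open scoped Manifold ContDiff
open CategoryTheory AlgebraicGeometry
open MvPolynomial (X)

universe u

/-! ### Generating sections of a composite `Y' → Y → ℙ(ι)` -/

namespace Literature.AlgebraicGeometry.Motives

namespace GeneratingSections

open Literature.AlgebraicGeometry.Motives.Segre

section OfHomComp

variable {ι : Type} {k : Type u} [CommRing k] {Y Y' : Scheme.{u}} (g : Y' ⟶ Y)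

/- The grading instance `MvPolynomial.gradedAlgebra` is not global (Mathlib); as in
`LefschetzOperatorAlgebraicClasses` it is supplied inside each statement by `letI`, rather than
by a file-wide `attribute [local instance]`. -/

/-- `(g ≫ r)⁻¹ D₊(xᵢ) = g⁻¹ (r⁻¹ D₊(xᵢ))` (definitional). [folklore] -/
theorem preU_comp (i : ι) :
    letI := MvPolynomial.gradedAlgebra (σ := ι) (R := k)
    ∀ r : Y ⟶ Proj (grading ι k), preU (g ≫ r) i = g ⁻¹ᵁ preU r i :=
  fun _ ↦ rfl

/-- The chart lift of a composite factors through the chart lift: on `(g ≫ r)⁻¹ D₊(xᵢ)`,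
`chartLift (g ≫ r) i = g| ≫ chartLift r i` (uniqueness of lifts through the open immersion
`D₊(xᵢ) → ℙ(ι)`). [folklore] -/
theorem chartLift_comp (i : ι) :
    letI := MvPolynomial.gradedAlgebra (σ := ι) (R := k)
    ∀ r : Y ⟶ Proj (grading ι k),
      chartLift (g ≫ r) i = g.resLE (preU r i) (preU (g ≫ r) i) le_rfl ≫ chartLift r i := by
  intro r
  exact (IsOpenImmersion.lift_uniq (chartι k i) ((preU (g ≫ r) i).ι ≫ g ≫ r) _ _ (by
    rw [Category.assoc, chartLift_chartι, Scheme.Hom.resLE_comp_ι_assoc])).symm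

/-- **The ratios of a composite are the pulled-back ratios**: `(g ≫ r)^*(x_j/x_i) = g^*(r^*(x_j/x_i))`
on `(g ≫ r)⁻¹ D₊(xᵢ) = g⁻¹(r⁻¹ D₊(xᵢ))` (Hartshorne II Thm. 7.1 (a): `sᵢ = φ^* xᵢ` is functorial).
[cite: Hartshorne1977, II Thm. 7.1 (a)] -/
theorem homRatio_comp (i j : ι) :
    letI := MvPolynomial.gradedAlgebra (σ := ι) (R := k)
    ∀ r : Y ⟶ Proj (grading ι k),
      homRatio (g ≫ r) i j = g.appLE (preU r i) (preU (g ≫ r) i) le_rfl (homRatio r i j) := by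
  intro r
  rw [homRatio, homRatio, chartLift_comp, pull_comp, RingHom.comp_apply]
  change ((g.resLE (preU r i) (preU (g ≫ r) i) le_rfl).appTop ≫ (preU (g ≫ r) i).topIso.hom)
      (pull (chartLift r i) (frac k i j)) =
    ((preU r i).topIso.hom ≫ g.appLE (preU r i) (preU (g ≫ r) i) le_rfl)
      (pull (chartLift r i) (frac k i j))
  rw [Scheme.Hom.appTop, Scheme.Hom.resLE_app_top, Category.assoc, Category.assoc, Iso.inv_hom_id,
    Category.comp_id]

end OfHomComp

/-! ### Values of the ratios of a composite at `L`-points -/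

section Points

variable {k : Type} [Field k] {X Y : SchemeOver k} {L : Type} [Field L] [Algebra k L]
  {N : ℕ} (ι : X ⟶ Y) (κ : Y ⟶ projectiveSpace N k)

/-- The charts of `ι ≫ κ` are the preimages of the charts of `κ` (definitional). [folklore] -/
theorem affineChartData_comp_U (j : Fin (N + 1)) :
    (affineChartData (ι ≫ κ)).U j = ι.left ⁻¹ᵁ (affineChartData κ).U j := rfl

/-- **The ratios `(ι ≫ κ)^*(xᵢ/xⱼ)` take at `P` the values of `κ^*(xᵢ/xⱼ)` at `ι(P)`** (total
evaluations; both vanish off the chart). [cite: Hartshorne1977, II Thm. 7.1 (a)] -/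
theorem evalOrZero_ratio_comp (j i : Fin (N + 1)) (P : AlgPoints X L) :
    AlgPoints.evalOrZero ((affineChartData (ι ≫ κ)).U j) ((affineChartData (ι ≫ κ)).ratio j i) P =
      AlgPoints.evalOrZero ((affineChartData κ).U j) ((affineChartData κ).ratio j i)
        (AlgPoints.map ι P) := by
  by_cases h : P.pt ∈ (affineChartData (ι ≫ κ)).U j
  · have h' : (AlgPoints.map ι P).pt ∈ (affineChartData κ).U j := h
    rw [AlgPoints.evalOrZero_of_mem _ h, AlgPoints.evalOrZero_of_mem _ h', AlgPoints.eval_map,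
      Scheme.Hom.app_eq_appLE]
    letI := MvPolynomial.gradedAlgebra (σ := Fin (N + 1)) (R := k)
    exact congrArg (P.eval _ h) (homRatio_comp ι.left j i κ.left)
  · have h' : (AlgPoints.map ι P).pt ∉ (affineChartData κ).U j := h
    rw [AlgPoints.evalOrZero_of_not_mem _ h, AlgPoints.evalOrZero_of_not_mem _ h']

end Points

end GeneratingSections

/-! ### The affine coordinates of a composite on analytifications -/

namespace AnalytificationKaehler

open Literature.Geometry.Kaehler Literature.NumberTheory.Transcendental

section Comp

variable {k : Type} [Field k] [Algebra k ℂ] {X Y : SchemeOver k}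
  {M : Type*} {M' : Type*} {N : ℕ} (ι : X ⟶ Y) (κ : Y ⟶ projectiveSpace N k)
  {φ : M → ComplexPoints X} {ψ : M' → ComplexPoints Y} {f : M → M'}
  (hf : ∀ m, ψ (f m) = AlgPoints.map ι (φ m))
include hf

/-- The chart domains of `ι ≫ κ` on `M` are the preimages of those of `κ` on `M'` under any map
`f : M → M'` over `ι(ℂ)`. [folklore] -/
theorem mem_chartDom_comp_iff (j : Fin (N + 1)) (m : M) :
    m ∈ chartDom (ι ≫ κ) φ j ↔ f m ∈ chartDom κ ψ j := by
  change (φ m).pt ∈ (GeneratingSections.affineChartData (ι ≫ κ)).U j ↔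
    (ψ (f m)).pt ∈ (GeneratingSections.affineChartData κ).U j
  rw [hf m]
  rfl

/-- **The affine coordinates are functorial**: `G_j^{ι ≫ κ} = G_j^κ ∘ f` for `f : M → M'` over
`ι(ℂ)` (the ratios of `ι ≫ κ` are the pulled-back ratios of `κ`). [cite: VoisinHodgeI2002, §3.3.2] -/
theorem coordVec_comp (j : Fin (N + 1)) (m : M) :
    coordVec (ι ≫ κ) φ j m = coordVec κ ψ j (f m) := by
  ext i
  simp only [coordVec_apply, coordFun, hf m]
  exact GeneratingSections.evalOrZero_ratio_comp ι κ j i (φ m)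

/-- Hence `G_j^{ι ≫ κ} = G_j^κ ∘ f` as functions. [cite: VoisinHodgeI2002, §3.3.2] -/
theorem coordVec_comp_eq (j : Fin (N + 1)) :
    coordVec (ι ≫ κ) φ j = coordVec κ ψ j ∘ f :=
  funext fun m ↦ coordVec_comp ι κ hf j m

end Comp

section Form

variable {k : Type} [Field k] [Algebra k ℂ] {X Y : SchemeOver k}
  {E : Type*} [NormedAddCommGroup E] [NormedSpace ℂ E]
  {E' : Type*} [NormedAddCommGroup E'] [NormedSpace ℂ E'] [FiniteDimensional ℂ E']
  {M : Type*} [TopologicalSpace M] [ChartedSpace E M]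
  {M' : Type*} [TopologicalSpace M'] [ChartedSpace E' M']
  {N : ℕ} (ι : X ⟶ Y) (κ : Y ⟶ projectiveSpace N k) [IsClosedImmersion κ.left]
  {φ : M → ComplexPoints X} {ψ : M' → ComplexPoints Y} {d' : ℕ}
  (hψ : IsAnalytification E' Y d' ψ)
  {f : M → M'} (hf : ∀ m, ψ (f m) = AlgPoints.map ι (φ m))
  (hfd : MDifferentiable 𝓘(ℂ, E) 𝓘(ℂ, E') f)
include hψ hf hfd

/-- **The restricted Fubini–Study form is functorial**: for `ι : X ⟶ Y`, a closed immersion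
`κ : Y ⟶ ℙᴺ`, an analytification `ψ : M' → Y(ℂ)`, any `φ : M → X(ℂ)` and a holomorphic
`f : M → M'` over `ι(ℂ)` (`ψ ∘ f = ι(ℂ) ∘ φ`), the pull-back of the form `θ_κ` of `M'` along `f` is
the form `θ_{ι ≫ κ}` of `M`: `f^* θ_κ = θ_{ι ≫ κ}` — both are `(G_j ∘ f)^* β₀ = f^*(G_j^* β₀)` on the
`j`-th chart (`coordVec_comp_eq`, chain rule). In print: the Kähler form of a projective submanifold
is the restriction of the Fubini–Study form, compatibly with further restriction.
[cite: VoisinHodgeI2002, §3.3.2] -/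
theorem fubiniStudyPullbackForm_pullback_comp :
    (fubiniStudyPullbackForm E' κ ψ).pullback 𝓘(ℝ, E) f = fubiniStudyPullbackForm E (ι ≫ κ) φ := by
  funext m
  set j := chartIndex (ι := ι ≫ κ) (φ := φ) m with hj
  have hm : m ∈ chartDom (ι ≫ κ) φ j := mem_chartDom_chartIndex m
  have hfm : f m ∈ chartDom κ ψ j := (mem_chartDom_comp_iff ι κ hf j m).1 hm
  have hG : MDifferentiableAt 𝓘(ℝ, E') 𝓘(ℝ, EuclideanSpace ℂ (Fin (N + 1))) (coordVec κ ψ j) (f m) :=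
    (mdifferentiableAt_coordVec hψ hfm).real_of_complex
  have hf' : MDifferentiableAt 𝓘(ℝ, E) 𝓘(ℝ, E') f m := (hfd m).real_of_complex
  -- the form of `κ` at `f m`, read in the chart `j`
  have hθ : fubiniStudyPullbackForm E' κ ψ (f m) = fsPullback E' (coordVec κ ψ j) (f m) :=
    (fubiniStudyPullbackForm_eventuallyEq hψ hfm).self_of_nhds
  change (fubiniStudyPullbackForm E' κ ψ).pullback 𝓘(ℝ, E) f m = fsPullback E (coordVec (ι ≫ κ) φ j) m
  ext v
  rw [MForm.pullback_apply, hθ, coordVec_comp_eq ι κ hf j, fsPullback, fsPullback,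
    MForm.pullback_apply, MForm.pullback_apply, mfderiv_comp m hG hf']
  rfl

end Form

end AnalytificationKaehler

end Literature.AlgebraicGeometry.Motives

/-! ### On Hodge models: the hyperplane-type form pulls back along `ι^an` -/

namespace Literature.AlgebraicGeometry.HodgeTheory

section HodgeTheory

open Literature.Geometry.Kaehler
open Literature.NumberTheory.Transcendental (complexDeRhamCohomology cclosedSmoothForms
  ofReal_mem_cclosedSmoothForms)
open Literature.AlgebraicGeometry.Motives.AnalytificationKaehler (fubiniStudyPullbackForm
  fubiniStudyPullbackForm_pullback_comp isSmoothForm_fubiniStudyPullbackForm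
  isClosedForm_fubiniStudyPullbackForm)

variable {n m : ℕ} {X Y : Motives.SchemeOver ℂ} (A : HodgeModel n X) (B : HodgeModel m Y)
  (ι : X ⟶ Y) {N : ℕ} (κ : Y ⟶ Motives.projectiveSpace N ℂ) [IsClosedImmersion κ.left]

namespace HodgeModel

/-- **`(ι^an)^* θ_κ = θ_{ι ≫ κ}` on Hodge models**: for Hodge models `A` of `X` and `B` of `Y` (both
smooth projective), a morphism `ι : X ⟶ Y` and a closed immersion `κ : Y ⟶ ℙᴺ`, the pull-back along
the holomorphic map `ι^an : A.carrier → B.carrier` (`HodgeModel.anMap`) of the restricted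
Fubini–Study form of `κ` is the restricted Fubini–Study form of `ι ≫ κ`.
[cite: VoisinHodgeI2002, §3.3.2] [cite: SerreGAGA1956, §2 n°5 (fonctorialité de X^h)] -/
theorem fubiniStudyPullbackForm_pullback_anMap (hX : Motives.IsSmoothProjective n X)
    (hY : Motives.IsSmoothProjective m Y) :
    (fubiniStudyPullbackForm B.model κ B.toComplexPoints).pullback 𝓘(ℝ, A.model) (anMap B A ι) =
      fubiniStudyPullbackForm A.model (ι ≫ κ) A.toComplexPoints :=
  fubiniStudyPullbackForm_pullback_comp ι κ B.isAnalytification (toComplexPoints_anMap B A ι)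
    (mdifferentiable_anMap B A ι hX hY)

/-- The restricted Fubini–Study form `θ_κ` of the closed immersion `κ : Y ⟶ ℙᴺ`, complexified, is
a closed smooth complex `2`-form on the Hodge model `B`. [cite: VoisinHodgeI2002, §3.3.2 Lemma 3.16] -/
theorem fubiniStudyPullbackForm_ofReal_mem_cclosedSmoothForms :
    (fubiniStudyPullbackForm B.model κ B.toComplexPoints).ofReal ∈ cclosedSmoothForms B.model B.carrier 2 :=
  ofReal_mem_cclosedSmoothForms ((mem_closedSmoothForms_iff _).2
    ⟨isSmoothForm_fubiniStudyPullbackForm B.isAnalytification,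
      isClosedForm_fubiniStudyPullbackForm B.isAnalytification⟩)

/-- **On complex de Rham classes: `(ι^an)^*_dR [θ_κ ⊗ 1] = [θ_{ι ≫ κ} ⊗ 1]`** in
`H²_dR(A.carrier; ℂ)` (granted `ι ≫ κ` is again a closed immersion, so that the right-hand side is
the hyperplane-type form of `X`). [cite: VoisinHodgeI2002, §3.3.2] -/
theorem map_anMap_mk_fubiniStudyPullbackForm [IsClosedImmersion (ι ≫ κ).left]
    (hX : Motives.IsSmoothProjective n X) (hY : Motives.IsSmoothProjective m Y) :
    complexDeRhamCohomology.map A.model (contMDiff_anMap B A ι hX hY) 2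
        (complexDeRhamCohomology.mk B.model B.carrier 2
          ⟨_, B.fubiniStudyPullbackForm_ofReal_mem_cclosedSmoothForms κ⟩) =
      complexDeRhamCohomology.mk A.model A.carrier 2
        ⟨_, A.fubiniStudyPullbackForm_ofReal_mem_cclosedSmoothForms (ι ≫ κ)⟩ := by
  rw [complexDeRhamCohomology.map_mk]
  congr 1
  refine Subtype.ext ?_
  change ((fubiniStudyPullbackForm B.model κ B.toComplexPoints).ofReal).pullback 𝓘(ℝ, A.model)
    (anMap B A ι) = (fubiniStudyPullbackForm A.model (ι ≫ κ) A.toComplexPoints).ofReal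
  rw [MForm.pullback_ofReal, A.fubiniStudyPullbackForm_pullback_anMap B ι κ hX hY]

end HodgeModel

end HodgeTheory

end Literature.AlgebraicGeometry.HodgeTheory

end
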